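import Summits.QuantumFields.YangMills.Theorems.UnitScaleTiltProp7TwistDefectOfRegPr
import Summits.QuantumFields.YangMills.Theorems.AlphaInputsT3ACv3NewtonLiftOneBlockCert
import Summits.QuantumFields.YangMills.Theorems.UnitScaleTiltProp7HSymObLift
import HarnessLib

/-!
# Route `UnitScaleTilt`, crux K1 child «MinimiserStabilityRegPr» (stmt-QuantumFields-19200), stub EX, route (α), node (AVG-SYM), row (46)∕M12 — **THE (hQR)-ASSEMBLY:
# THE COVARIANT CANDIDATE `Rcov U₀` (the one-block kernel twisted by the `U₀`-transport frames, `ℂ`-LINEAR) AND ITS TWO ROWS `(hR) ‖Rcov X‖ ≤ (1056∕L^{K−n})‖X‖`,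
# `(hQR) ‖QSym U₀ (Rcov X) − X‖ ≤ ½‖X‖` FROM (T1) + (T2) — HENCE PRINT'S LETTER `H` OF (45)–(46) FOR THE ROUTE'S SYMMETRIC AVERAGE AT A `RegPr` BACKGROUND**

Cell `ym3-torus`, width seat `ym-ust-20520-w3` (gen 4); ★w2-19200 g2 RULING EX-KNIT №1 (2026-08-28T04:02Z, acting per ★★OWNER g25 closing notice) (R1): «RE-POINT ★w3-20520 g4 := the
(hQR)-ASSEMBLY = `Theorems/UnitScaleTiltProp7QSymCovCandidate.lean`: (i) the COVARIANT CANDIDATE `Rcov U₀` — M18 §3's twisted port `byEntryTw (obLiftL F K (K−n)) ψ_{U₀}` … read through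
`bondShift` as a ℂ-linear map, with (hR) `‖Rcov U₀ X‖ ≤ B₁‖X‖`, `B₁ = 1056∕L^{K−n}`; (ii) (hQR) `‖QSym F n K h U₀ (Rcov U₀ X) − X‖ ≤ ½‖X‖` by the triangle inequality from (T1) + (T2);
conclusion = EXACTLY the `hrows` of `Prop7HSym.exists_rightInv_QSym_of_rows` ⇒ `Hf`».  THEOREMS ONLY (0 `def`, 0 `sorry`).  YM₃ on T³ is a ladder rung (R3), NOT the Clay problem;
nothing here claims the stub, the crux, d = 4 or the mass gap.  `--supports stmt-QuantumFields-19200 --as helper`; count-neutral.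

THE PRINT.  [Balaban1985Variational] p. 285: *«The operators Δ, Q and R define the operator H … LʲηQ_jHB = B on Λ_j, RD*HB = 0, (45) and the Theorem 3.12 from [5] implies
|HB| ≤ B₀(Lʲη)⁻¹|B| … (46)»*; [Balaban1985Averaging] (11)–(13) p. 19 (gauge covariance of the averages: the route to a COVARIANT right inverse at a curved background is to
lift in the block axial gauges of `U₀` and undo the gauge).

THE ARGUMENT (all by name).  Convention of record (★w4-19200 g2 04:01:48Z): one comb gauge per coarse bond, `σ_c := axialT U₀ (toFine (K−n) c₋)` (block CENTRE), frames
`ψ_σ(b,c′) = Ad(σ_{c′}(b₋)⁻¹σ_{c′}^{(K−n)}(c′₋))` (`NewtonLiftFramed.exists_gaugeFrames`).  (i) `Rcov X := byEntryTw (obLiftL F K (K−n)) ψ_σ (X ∘ bondShift⁻¹)` is `ℂ`-LINEAR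
(the kernel is real, the frames are conjugations) with `‖Rcov X‖ ≤ (1056∕L^{K−n})‖X‖` (`norm_byEntryTw_le_sup` ∘ `obLift_rowB`, frames isometric).  (ii) For a coarse route bond
`c` write `Y := Rcov X`, `T_c := σ_c^{(K−n)}(c₋)`; then `QSym U₀ Y c − X c = [QSym U₀ Y c − T_c*·QSym 1 (Ad_{σ_c}Y) c·T_c] + [T_c*·Q^{(K−n)}(Ad_{σ_c}Y)(c)·T_c − X c]`
(`QSym_one_apply`: `QSym 1 = Q^{(K−n)} ∘ bondShift`); the first bracket is (T2) (★w4-20520 g2 `…Prop7QSymCovDefect(T3∕OfRegPr)`: `≤ δ‖Y‖ ≤ δ·(1056∕L^{K−n})‖X‖`), the second is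
(T1) (`hRinv_of_gaugeFrames` at `ω = 8ε₀` by ★w4-19200 g2's `osc_centreAxial_of_regPr`: `≤ 67584·ε₀‖X‖`); so (hQR) holds under the window `δ·1056∕L^{K−n} + 67584ε₀ ≤ ½`,
and `Prop7HSym.exists_rightInv_QSym_of_approx` gives `H` with `QSym U₀ ∘ H = id`, `‖HX‖ ≤ 2·(1056∕L^{K−n})‖X‖`.

WHAT THIS FILE PROVES (sorry-free, def-free).
* §1 ★ `exists_obLift_gaugeKernel_complex` — the ★w4-19936 g2 certificate `NewtonLiftFramed.exists_obLift_gaugeKernel` ((α) `𝔰𝔲`-row, (β) sup row `1056∕Lᵏ`, (γ) twisted exactness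
  defect from the frame oscillation `ω`) with the twisted port packaged as a **`ℂ`-LINEAR** map (the (δ) curl row is the Newton lift's and is dropped) — the `→ₗ[ℂ]` is what
  `B11Prop3Model.Inputs`∕`Chart47T3sym` require of `H`, and it is NOT recoverable from the `→ₗ[ℝ]` statement of record, hence re-certified here from the same letters.
* §2 ★★ `norm_QSym_comp_sub_le_of_rows` — THE (hQR) TRIANGLE, rows displayed: any gauges `σ`, any `ℂ`-linear `R₀` with (β) `‖R₀u‖ ≤ B₁‖u‖` and (γ) defect `θ‖u‖` in the
  `σ_c`-rotated flat currency, and the (T2) row `δ‖Y‖` ⟹ for `Rcov := R₀ ∘ (· ∘ bondShift⁻¹)`: `‖QSym U₀ (Rcov X) − X‖ ≤ (δB₁ + θ)‖X‖`; ★★ `exists_rightInv_QSym_of_T1T2` — with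
  `δB₁ + θ ≤ ½`: `∃ H, QSym U₀ ∘ H = id ∧ ‖HX‖ ≤ 2B₁‖X‖` (`Prop7HSym.exists_rightInv_QSym_of_approx`).
* §3 ★★★ `exists_rightInv_QSym_of_regPr_of_T2` — AT A `RegPr F n K ε₀ U₀` BACKGROUND with the centre-axial gauges of record: (β)∕(γ) DISCHARGED (§1 + `osc_centreAxial_of_regPr`,
  `θ = 67584ε₀`, `B₁ = 1056∕L^{K−n}`), the (T2) row displayed VERBATIM in (T1)'s letters (`hT2`, supplier ★w4-20520 g2), window `δ·(1056∕L^{K−n}) + 67584ε₀ ≤ ½` ⟹ print's `H`: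
  `QSym F n K h U₀ (H X) = X`, `‖H X‖ ≤ 2·(1056∕L^{K−n})·‖X‖` — k-UNIFORM `B_H = 2112` after `L^{K−n} ≥ 1` (`exists_rightInv_QSym_of_regPr_of_T2_abs`).
HONEST SCOPE.  Assembly by name; the ONE displayed row is (T2) (`hT2`) until ★w4-20520 g2's `…Prop7QSymCovDefectOfRegPr` lands (then a 5-line corollary instantiates it); the no-wrap
margin `4L^{K−n} ≤ |T⁽⁰⁾|` of (T1) is displayed as there.  Print's Landau property `RD*H = 0` and Thm 3.12's derivative bounds are NOT part of M12 and are not claimed.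

References: T. Bałaban, CMP **102** (1985) 277–309 [Balaban1985Variational] ((44)–(48) p.285); CMP **98** (1985) 17–51 [Balaban1985Averaging] ((8)–(13) pp.18–19, (19) p.21,
pp.24–25); CMP **109** (1987) 249–301 [Balaban1987RG1] ((0.4), (0.11) p.253, (0.21) p.256).
-/

set_option autoImplicit false

noncomputable section

open scoped BigOperators Matrix.Norms.L2Operator

namespace Summit.QuantumFields.YangMills.Theorems.Prop7QSymCovCandidate

open Literature.MathematicalPhysics.QuantumFieldTheory.Balaban1983to89
open Literature.MathematicalPhysics.QuantumFieldTheory.Balaban1983to89.T3ContinuumYM3Torus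
open Literature.MathematicalPhysics.QuantumFieldTheory.Balaban1983to89.T3PrintedRegularMinimiser (RegPr)
open Literature.MathematicalPhysics.QuantumFieldTheory.Balaban1983to89.T3SectALandauChart (pos_of_regPr)
open Literature.MathematicalPhysics.QuantumFieldTheory.Balaban1983to89.T4AdjointCovarianceUnitary (lieSU)
open Literature.MathematicalPhysics.QuantumFieldTheory.Balaban1983to89.B5Eq118OneStroke (iterBlockOf)
open Literature.MathematicalPhysics.QuantumFieldTheory.Balaban1983to89.B10Eq38TorusDomains (toFine)
open B10Eq27TorusAxialLog (axialT)
open T4Continuum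
open T3LevelShift (bondShift)
open Summit.QuantumFields.Balaban3D.Carriers (coarsen)
open Summit.QuantumFields.YangMills.Theorems.AbelianEML (linAvgIter)
open Summit.QuantumFields.YangMills.Theorems.AbelianEML.Tensor (le_standing)
open Summit.QuantumFields.YangMills.Theorems.AbelianEML.OneBlock (obLiftL linAvgIter_obLiftL)
open Summit.QuantumFields.YangMills.Theorems.LinearLiftMatrix (byEntryTw byEntryTw_def byEntryTw_mem linAvgIterM linAvgIterM_zero linAvgIterM_succ)
open Summit.QuantumFields.YangMills.Theorems.NewtonLiftFramed (exists_gaugeFrames gaugeFrame_mem_lieSU norm_gaugeFrame_eq hRinv_of_gaugeFrames norm_byEntryTw_le_sup obLift_rowB)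
open Summit.QuantumFields.YangMills.Theorems.Prop7SymAvgGL (QSym)
open Summit.QuantumFields.YangMills.Theorems.Prop7QSymFlat (QSym_one_apply)
open Summit.QuantumFields.YangMills.Theorems.Prop7HSym (exists_rightInv_QSym_of_approx)
open Summit.QuantumFields.YangMills.Theorems.Prop7HSymObLift (three_le_pow_L)
open Summit.QuantumFields.YangMills.Theorems.Prop7TwistDefectOfRegPr (osc_centreAxial_of_regPr)

/-! ## §1 The twisted one-block kernel at gauge frames, packaged `ℂ`-linearly -/

section Complex

variable {N : Type*} {ι κ : Type*} [Fintype ι] [DecidableEq ι]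

/-- **A TWISTED KERNEL WITH `ℂ`-HOMOGENEOUS FRAMES IS A `ℂ`-LINEAR MAP OF THE DATA** (real kernel `T(δ_c)(b)`, frames `ψ b c` commuting with complex scalars — e.g. conjugations):
`∃ R₀ : (ι → M_N(ℂ)) →ₗ[ℂ] (κ → M_N(ℂ))` with `R₀ u = byEntryTw T ψ u` (the `ℂ`-twin of `NewtonLiftFramed.exists_byEntryTw_linearMap`; consumers `obtain ⟨R₀, hR₀⟩`, no definition). [folklore] -/
theorem exists_byEntryTw_linearMapC (T : (ι → ℝ) →ₗ[ℝ] (κ → ℝ)) (ψ : κ → ι → Matrix N N ℂ →ₗ[ℝ] Matrix N N ℂ)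
    (hψ : ∀ (b : κ) (c : ι) (z : ℂ) (Y : Matrix N N ℂ), ψ b c (z • Y) = z • ψ b c Y) :
    ∃ R₀ : (ι → Matrix N N ℂ) →ₗ[ℂ] (κ → Matrix N N ℂ), ∀ u, R₀ u = byEntryTw T ψ u := by
  refine ⟨{ toFun := byEntryTw T ψ, map_add' := fun u v => ?_, map_smul' := fun z u => ?_ }, fun u => rfl⟩
  · funext b
    simp only [byEntryTw_def, Pi.add_apply, map_add, smul_add, Finset.sum_add_distrib]
  · funext b
    simp only [byEntryTw_def, Pi.smul_apply, hψ, RingHom.id_apply, Finset.smul_sum]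
    exact Finset.sum_congr rfl fun c _ => smul_comm _ _ _

variable [Fintype N] [DecidableEq N] [Nonempty N] {F : T3Family} {K k : ℕ}

/-- ★ **THE `obLift` CERTIFICATE WITH A `ℂ`-LINEAR TWISTED PORT** (★w4-19936 g2's `NewtonLiftFramed.exists_obLift_gaugeKernel`, rows (α)(β)(γ), re-certified with `→ₗ[ℂ]`): for
`k ≤ K`, `3 ≤ Lᵏ` and ANY gauges `σ` (one per coarse bond), the port `R₀ u := byEntryTw (obLiftL F K k) ψ_σ u` of the one-block kernel through the transport frames
`ψ_σ(b,c′) = Ad(σ_{c′}(b₋)⁻¹σ_{c′}^{(k)}(c′₋))` is `ℂ`-LINEAR (real kernel, conjugation frames) and: (α) `𝔰𝔲`-valued data give `𝔰𝔲`-valued fields; (β) `‖R₀u‖ ≤ (1056∕Lᵏ)‖u‖`;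
(γ) for every coarse bond `c`, if the relative gauges `σ_cσ_{c′}⁻¹` oscillate by at most `ω` on the kernel support of the two blocks of `c`, then
`‖σ_c^{(k)}(c₋)*·Q^{(k)}(b ↦ σ_c(b₋)(R₀u)_bσ_c(b₋)*)(c)·σ_c^{(k)}(c₋) − u(c)‖ ≤ ((d+1)Lᵏ)·((1056∕Lᵏ)·(2ω·‖u‖))`.
[cite: Balaban1985Averaging, (11)-(13) p.19, (19) p.21, pp.24-25; Balaban1987RG1, (0.4)+(0.11) p.253] -/
theorem exists_obLift_gaugeKernel_complex (hk : k ≤ K) (hn3 : 3 ≤ F.L ^ k) (σ : PBond (F.P K) k → GaugeTransf (F.P K) 0 (Matrix.specialUnitaryGroup N ℂ)) :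
    ∃ R₀ : (PBond (F.P K) k → Matrix N N ℂ) →ₗ[ℂ] (PBond (F.P K) 0 → Matrix N N ℂ),
      (∀ u : PBond (F.P K) k → Matrix N N ℂ, (∀ c, u c ∈ lieSU N) → ∀ b, R₀ u b ∈ lieSU N) ∧
      (∀ u : PBond (F.P K) k → Matrix N N ℂ, ‖R₀ u‖ ≤ (1056 / (F.L : ℝ) ^ k) * ‖u‖) ∧
      (∀ (c : PBond (F.P K) k) (u : PBond (F.P K) k → Matrix N N ℂ) (ω : ℝ), 0 ≤ ω →
        (∀ b : PBond (F.P K) 0, (iterBlockOf k b.src = c.src ∨ iterBlockOf k b.src = c.tgt) → (iterBlockOf k b.tgt = c.src ∨ iterBlockOf k b.tgt = c.tgt) →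
          ∀ c' : PBond (F.P K) k, c'.src = coarsen k b.src →
            ‖((σ c b.src * (σ c' b.src)⁻¹ : Matrix.specialUnitaryGroup N ℂ) : Matrix N N ℂ) -
              ((transfUp (σ c) k c'.src * (transfUp (σ c') k c'.src)⁻¹ : Matrix.specialUnitaryGroup N ℂ) : Matrix N N ℂ)‖ ≤ ω) →
        ‖star (transfUp (σ c) k c.src : Matrix N N ℂ) *
              linAvgIterM k (fun b => ((σ c b.src : Matrix.specialUnitaryGroup N ℂ) : Matrix N N ℂ) * R₀ u b * star (σ c b.src : Matrix N N ℂ)) c *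
              (transfUp (σ c) k c.src : Matrix N N ℂ) - u c‖ ≤
          ((((F.P K).d : ℝ) + 1) * (F.L : ℝ) ^ k) * ((1056 / (F.L : ℝ) ^ k) * ((2 * ω) * ‖u‖))) := by
  -- the bond-decidability of the NewtonLift files (classical; a global `DecidableEq (PBond _ _)` instance is in scope here and must not be picked up)
  letI hdec : DecidableEq (PBond (F.P K) k) := fun a b => Classical.propDecidable (a = b)
  obtain ⟨ψ, hψ⟩ := exists_gaugeFrames (k := k) σ
  -- the frames are `ℂ`-homogeneous (conjugations)
  have hψz : ∀ (b : PBond (F.P K) 0) (c' : PBond (F.P K) k) (z : ℂ) (Y : Matrix N N ℂ), ψ b c' (z • Y) = z • ψ b c' Y := by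
    intro b c' z Y
    rw [hψ, hψ, mul_smul_comm, smul_mul_assoc, smul_mul_assoc]
  obtain ⟨R₀, hR₀⟩ := exists_byEntryTw_linearMapC (obLiftL F K k) ψ hψz
  have hk' : k ≤ (F.P K).m + (F.P K).K := le_standing hk
  let Nb : PBond (F.P K) 0 → PBond (F.P K) k → Prop := fun b c' => c'.src = coarsen k b.src
  have hB : ∀ (f : PBond (F.P K) k → ℝ) (M : ℝ) (b : PBond (F.P K) 0), (∀ c', Nb b c' → |f c'| ≤ M) → |obLiftL F K k f b| ≤ (1056 / (F.L : ℝ) ^ k) * M :=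
    obLift_rowB hk hn3
  have hE : ∀ f : PBond (F.P K) k → ℝ, linAvgIter k (obLiftL F K k f) = f := linAvgIter_obLiftL hk hn3
  have hρ : (0 : ℝ) ≤ 1056 / (F.L : ℝ) ^ k := by positivity
  refine ⟨R₀, fun u hu b => ?_, fun u => ?_, fun c u ω hω hosc => ?_⟩
  · -- (α)
    rw [hR₀]; exact byEntryTw_mem (obLiftL F K k) ψ (lieSU N) (fun b c X hX => gaugeFrame_mem_lieSU σ ψ hψ b c hX) hu b
  · -- (β)
    rw [hR₀]; exact norm_byEntryTw_le_sup (obLiftL F K k) Nb hB hρ ψ (fun b c X => (norm_gaugeFrame_eq σ ψ hψ b c X).le) u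
  · -- (γ)
    have h := hRinv_of_gaugeFrames (obLiftL F K k) Nb hB σ ψ hψ hk' hE c u (fun c' => norm_le_pi_norm u c') hω
      (fun b hb1 hb2 c' hc => hosc b hb1 hb2 c' hc)
    have e : (fun b : PBond (F.P K) 0 => ((σ c b.src : Matrix.specialUnitaryGroup N ℂ) : Matrix N N ℂ) * R₀ u b * star (σ c b.src : Matrix N N ℂ)) =
        fun b => ((σ c b.src : Matrix.specialUnitaryGroup N ℂ) : Matrix N N ℂ) * byEntryTw (obLiftL F K k) ψ u b * star (σ c b.src : Matrix N N ℂ) := by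
      funext b; rw [hR₀]
    rw [e]; exact h

end Complex

/-! ## §2 The (hQR) triangle from the rows (β), (γ) = (T1) and (T2), and the right inverse -/

section Rows

variable (F : T3Family) {n K : ℕ} (h : n ≤ K)

/-- ★★ **THE (hQR) TRIANGLE, ROWS DISPLAYED.**  Gauges `σ` (one per coarse bond of `F.P K` at height `K − n`), a `ℂ`-linear port `R₀` of coarse data to fine one-forms with
(β) `‖R₀u‖ ≤ B₁‖u‖` and (γ) = (T1) the twisted exactness defect `θ‖u‖` in the `σ_c`-rotated FLAT-average currency, and (T2) the covariant defect row of the symmetric linearised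
chart `‖QSym U₀ Y c − T_c*·QSym 1 (Ad_{σ_c}Y) c·T_c‖ ≤ δ‖Y‖` (`T_c = σ_c^{(K−n)}(c₋)`, `c` read on `F.P K` through `bondShift`).  Then the covariant candidate
`Rcov := R₀ ∘ (X ↦ X ∘ bondShift⁻¹)` satisfies `‖QSym F n K h U₀ (Rcov X) − X‖ ≤ (δB₁ + θ)·‖X‖` (sup norms) — `QSym_one_apply` turns `QSym 1 (Ad Y) c` into
`Q^{(K−n)}(Ad Y)(bondShift c)`, then the triangle inequality. [cite: Balaban1985Variational, (45)-(46) p.285; Balaban1985Averaging, (11)-(13) p.19] -/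
theorem norm_QSym_comp_sub_le_of_rows (U₀ : GaugeField (F.P K) 0 (Matrix.specialUnitaryGroup (Fin 2) ℂ))
    (σ : PBond (F.P K) (K - n) → GaugeTransf (F.P K) 0 (Matrix.specialUnitaryGroup (Fin 2) ℂ))
    (R₀ : (PBond (F.P K) (K - n) → Matrix (Fin 2) (Fin 2) ℂ) →ₗ[ℂ] (PBond (F.P K) 0 → Matrix (Fin 2) (Fin 2) ℂ)) {B₁ θ δ : ℝ} (hB₁ : 0 ≤ B₁) (hθ : 0 ≤ θ) (hδ : 0 ≤ δ)
    (hβ : ∀ u, ‖R₀ u‖ ≤ B₁ * ‖u‖)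
    (hγ : ∀ (c : PBond (F.P K) (K - n)) (u : PBond (F.P K) (K - n) → Matrix (Fin 2) (Fin 2) ℂ),
      ‖star (transfUp (σ c) (K - n) c.src : Matrix (Fin 2) (Fin 2) ℂ) *
            linAvgIterM (K - n) (fun b => ((σ c b.src : Matrix.specialUnitaryGroup (Fin 2) ℂ) : Matrix (Fin 2) (Fin 2) ℂ) * R₀ u b * star (σ c b.src : Matrix (Fin 2) (Fin 2) ℂ)) c *
            (transfUp (σ c) (K - n) c.src : Matrix (Fin 2) (Fin 2) ℂ) - u c‖ ≤ θ * ‖u‖)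
    (hT2 : ∀ (Y : PBond (F.P K) 0 → Matrix (Fin 2) (Fin 2) ℂ) (c : PBond (F.P n) 0),
      ‖QSym F n K h U₀ Y c -
          star (transfUp (σ (bondShift (F.sitesPerDir_eq (m := F.m) (K := n) (j := 0) (m' := F.m) (K' := K) (j' := K - n) (by omega)) c)) (K - n)
              (bondShift (F.sitesPerDir_eq (m := F.m) (K := n) (j := 0) (m' := F.m) (K' := K) (j' := K - n) (by omega)) c).src : Matrix (Fin 2) (Fin 2) ℂ) *
            QSym F n K h 1 (fun b => ((σ (bondShift (F.sitesPerDir_eq (m := F.m) (K := n) (j := 0) (m' := F.m) (K' := K) (j' := K - n) (by omega)) c) b.src :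
                Matrix.specialUnitaryGroup (Fin 2) ℂ) : Matrix (Fin 2) (Fin 2) ℂ) * Y b *
              star (σ (bondShift (F.sitesPerDir_eq (m := F.m) (K := n) (j := 0) (m' := F.m) (K' := K) (j' := K - n) (by omega)) c) b.src : Matrix (Fin 2) (Fin 2) ℂ)) c *
            (transfUp (σ (bondShift (F.sitesPerDir_eq (m := F.m) (K := n) (j := 0) (m' := F.m) (K' := K) (j' := K - n) (by omega)) c)) (K - n)
              (bondShift (F.sitesPerDir_eq (m := F.m) (K := n) (j := 0) (m' := F.m) (K' := K) (j' := K - n) (by omega)) c).src : Matrix (Fin 2) (Fin 2) ℂ)‖ ≤ δ * ‖Y‖) :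
    ∀ X : PBond (F.P n) 0 → Matrix (Fin 2) (Fin 2) ℂ,
      ‖QSym F n K h U₀ ((R₀ ∘ₗ LinearMap.funLeft ℂ (Matrix (Fin 2) (Fin 2) ℂ)
            (bondShift (F.sitesPerDir_eq (m := F.m) (K := n) (j := 0) (m' := F.m) (K' := K) (j' := K - n) (by omega))).symm) X) - X‖ ≤ (δ * B₁ + θ) * ‖X‖ := by
  intro X
  set E := bondShift (F.sitesPerDir_eq (m := F.m) (K := n) (j := 0) (m' := F.m) (K' := K) (j' := K - n) (by omega)) with hE
  -- the pulled-back coarse data `u = X ∘ E⁻¹` and the candidate's value `R₀ u`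
  set u : PBond (F.P K) (K - n) → Matrix (Fin 2) (Fin 2) ℂ := fun c' => X (E.symm c') with hu
  change ‖QSym F n K h U₀ (R₀ u) - X‖ ≤ (δ * B₁ + θ) * ‖X‖
  have hun : ‖u‖ ≤ ‖X‖ := (pi_norm_le_iff_of_nonneg (norm_nonneg X)).2 fun c' => norm_le_pi_norm X (E.symm c')
  have hYn : ‖R₀ u‖ ≤ B₁ * ‖X‖ := (hβ u).trans (mul_le_mul_of_nonneg_left hun hB₁)
  have hC : 0 ≤ (δ * B₁ + θ) * ‖X‖ := by positivity
  refine (pi_norm_le_iff_of_nonneg hC).2 fun c => ?_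
  rw [Pi.sub_apply]
  -- letters at the coarse bond `c`
  set Tc : Matrix (Fin 2) (Fin 2) ℂ := (transfUp (σ (E c)) (K - n) (E c).src : Matrix (Fin 2) (Fin 2) ℂ) with hTc
  set AdY : PBond (F.P K) 0 → Matrix (Fin 2) (Fin 2) ℂ :=
    fun b => ((σ (E c) b.src : Matrix.specialUnitaryGroup (Fin 2) ℂ) : Matrix (Fin 2) (Fin 2) ℂ) * R₀ u b * star (σ (E c) b.src : Matrix (Fin 2) (Fin 2) ℂ) with hAdY
  -- (T2) at `Y := R₀ u`
  have h2 : ‖QSym F n K h U₀ (R₀ u) c - star Tc * QSym F n K h 1 AdY c * Tc‖ ≤ δ * ‖R₀ u‖ := hT2 (R₀ u) c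
  -- (T1) at `u`, read through `QSym_one_apply`
  have hflat : QSym F n K h 1 AdY c = linAvgIterM (K - n) AdY (E c) :=
    QSym_one_apply F h linAvgIterM linAvgIterM_zero linAvgIterM_succ AdY c
  have hue : u (E c) = X c := by
    show X (E.symm (E c)) = X c
    rw [Equiv.symm_apply_apply]
  have h1 : ‖star Tc * QSym F n K h 1 AdY c * Tc - X c‖ ≤ θ * ‖u‖ := by
    rw [hflat, ← hue]
    exact hγ (E c) u
  calc ‖QSym F n K h U₀ (R₀ u) c - X c‖
      = ‖(QSym F n K h U₀ (R₀ u) c - star Tc * QSym F n K h 1 AdY c * Tc) + (star Tc * QSym F n K h 1 AdY c * Tc - X c)‖ := by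
        rw [sub_add_sub_cancel]
    _ ≤ ‖QSym F n K h U₀ (R₀ u) c - star Tc * QSym F n K h 1 AdY c * Tc‖ + ‖star Tc * QSym F n K h 1 AdY c * Tc - X c‖ := norm_add_le _ _
    _ ≤ δ * ‖R₀ u‖ + θ * ‖u‖ := add_le_add h2 h1
    _ ≤ δ * (B₁ * ‖X‖) + θ * ‖X‖ := add_le_add (mul_le_mul_of_nonneg_left hYn hδ) (mul_le_mul_of_nonneg_left hun hθ)
    _ = (δ * B₁ + θ) * ‖X‖ := by ring

/-- ★★ **PRINT'S `H` FROM (β), (T1), (T2) AND THE WINDOW** `δB₁ + θ ≤ ½`: there is a `ℂ`-linear `H` from coarse one-forms on `PBond (F.P n) 0` to fine one-forms on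
`PBond (F.P K) 0` with `QSym F n K h U₀ (H X) = X` (EXACT right inverse, (45)) and `‖H X‖ ≤ 2B₁‖X‖` ((46), sup norms) — §2's triangle fed to ★w2-19200 g2's
`Prop7HSym.exists_rightInv_QSym_of_approx` at the candidate `Rcov = R₀ ∘ (· ∘ bondShift⁻¹)`. [cite: Balaban1985Variational, (45)-(47) p.285] -/
theorem exists_rightInv_QSym_of_T1T2 (U₀ : GaugeField (F.P K) 0 (Matrix.specialUnitaryGroup (Fin 2) ℂ))
    (σ : PBond (F.P K) (K - n) → GaugeTransf (F.P K) 0 (Matrix.specialUnitaryGroup (Fin 2) ℂ))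
    (R₀ : (PBond (F.P K) (K - n) → Matrix (Fin 2) (Fin 2) ℂ) →ₗ[ℂ] (PBond (F.P K) 0 → Matrix (Fin 2) (Fin 2) ℂ)) {B₁ θ δ : ℝ} (hB₁ : 0 ≤ B₁) (hθ : 0 ≤ θ) (hδ : 0 ≤ δ)
    (hβ : ∀ u, ‖R₀ u‖ ≤ B₁ * ‖u‖)
    (hγ : ∀ (c : PBond (F.P K) (K - n)) (u : PBond (F.P K) (K - n) → Matrix (Fin 2) (Fin 2) ℂ),
      ‖star (transfUp (σ c) (K - n) c.src : Matrix (Fin 2) (Fin 2) ℂ) *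
            linAvgIterM (K - n) (fun b => ((σ c b.src : Matrix.specialUnitaryGroup (Fin 2) ℂ) : Matrix (Fin 2) (Fin 2) ℂ) * R₀ u b * star (σ c b.src : Matrix (Fin 2) (Fin 2) ℂ)) c *
            (transfUp (σ c) (K - n) c.src : Matrix (Fin 2) (Fin 2) ℂ) - u c‖ ≤ θ * ‖u‖)
    (hT2 : ∀ (Y : PBond (F.P K) 0 → Matrix (Fin 2) (Fin 2) ℂ) (c : PBond (F.P n) 0),
      ‖QSym F n K h U₀ Y c -
          star (transfUp (σ (bondShift (F.sitesPerDir_eq (m := F.m) (K := n) (j := 0) (m' := F.m) (K' := K) (j' := K - n) (by omega)) c)) (K - n)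
              (bondShift (F.sitesPerDir_eq (m := F.m) (K := n) (j := 0) (m' := F.m) (K' := K) (j' := K - n) (by omega)) c).src : Matrix (Fin 2) (Fin 2) ℂ) *
            QSym F n K h 1 (fun b => ((σ (bondShift (F.sitesPerDir_eq (m := F.m) (K := n) (j := 0) (m' := F.m) (K' := K) (j' := K - n) (by omega)) c) b.src :
                Matrix.specialUnitaryGroup (Fin 2) ℂ) : Matrix (Fin 2) (Fin 2) ℂ) * Y b *
              star (σ (bondShift (F.sitesPerDir_eq (m := F.m) (K := n) (j := 0) (m' := F.m) (K' := K) (j' := K - n) (by omega)) c) b.src : Matrix (Fin 2) (Fin 2) ℂ)) c *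
            (transfUp (σ (bondShift (F.sitesPerDir_eq (m := F.m) (K := n) (j := 0) (m' := F.m) (K' := K) (j' := K - n) (by omega)) c)) (K - n)
              (bondShift (F.sitesPerDir_eq (m := F.m) (K := n) (j := 0) (m' := F.m) (K' := K) (j' := K - n) (by omega)) c).src : Matrix (Fin 2) (Fin 2) ℂ)‖ ≤ δ * ‖Y‖)
    (hwin : δ * B₁ + θ ≤ 1 / 2) :
    ∃ H : (PBond (F.P n) 0 → Matrix (Fin 2) (Fin 2) ℂ) →ₗ[ℂ] (PBond (F.P K) 0 → Matrix (Fin 2) (Fin 2) ℂ),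
      (∀ X, QSym F n K h U₀ (H X) = X) ∧ ∀ X, ‖H X‖ ≤ 2 * B₁ * ‖X‖ := by
  set e : PBond (F.P n) 0 ≃ PBond (F.P K) (K - n) :=
    bondShift (F.sitesPerDir_eq (m := F.m) (K := n) (j := 0) (m' := F.m) (K' := K) (j' := K - n) (by omega)) with he
  have htri := norm_QSym_comp_sub_le_of_rows F h U₀ σ R₀ hB₁ hθ hδ hβ hγ hT2
  refine exists_rightInv_QSym_of_approx F h U₀ (R₀ ∘ₗ LinearMap.funLeft ℂ (Matrix (Fin 2) (Fin 2) ℂ) e.symm) hB₁ (fun X => ?_) (fun X => ?_)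
  · -- (hR): `‖R₀ (X ∘ e⁻¹)‖ ≤ B₁‖X ∘ e⁻¹‖ ≤ B₁‖X‖`
    rw [LinearMap.comp_apply]
    refine (hβ _).trans (mul_le_mul_of_nonneg_left ?_ hB₁)
    exact (pi_norm_le_iff_of_nonneg (norm_nonneg X)).2 fun c' => by rw [LinearMap.funLeft_apply]; exact norm_le_pi_norm X _
  · exact (htri X).trans (mul_le_mul_of_nonneg_right hwin (norm_nonneg X))

end Rows

/-! ## §3 At a `RegPr` background with the centre-axial gauges of record: (β)∕(T1) discharged, (T2) displayed -/

section RegPr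

variable (F : T3Family) {n K : ℕ} (h : n ≤ K)

/-- ★★★ **PRINT'S LETTER `H` OF (45)–(46) FOR THE ROUTE'S SYMMETRIC AVERAGE AT A `RegPr` BACKGROUND, MODULO THE (T2) ROW.**  For `U₀ ∈ 𝔘_k(ε₀)` (`RegPr F n K ε₀ U₀`), `n < K`,
the no-wrap margin `4L^{K−n} ≤ |T⁽⁰⁾|`, the centre-anchored axial gauges `σ_c := axialT U₀ (toFine (K−n) c₋)` (convention of record), and the (T2) row at them
(`hT2`, constant `δ`; supplier ★w4-20520 g2's `…Prop7QSymCovDefectOfRegPr`), under the window `δ·(1056∕L^{K−n}) + 67584·ε₀ ≤ ½`: there is a `ℂ`-linear `H` with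
`QSym F n K h U₀ (H X) = X` for every coarse `X` and `‖H X‖ ≤ 2·(1056∕L^{K−n})·‖X‖` — (β) and (T1) DISCHARGED by §1 and ★w4-19200 g2's `osc_centreAxial_of_regPr` (`ω = 8ε₀`,
`θ = 67584ε₀`).  This is the `hop`∕`B₀` of `B11Prop3Model.Inputs (CmapSym U₀) H …` with (45). [cite: Balaban1985Variational, (45)-(47) p.285; Balaban1985Averaging, (11)-(13) p.19, pp.24-25] -/
theorem exists_rightInv_QSym_of_regPr_of_T2 (hnK : n < K) {ε₀ : ℝ} {U₀ : GaugeField (F.P K) 0 (Matrix.specialUnitaryGroup (Fin 2) ℂ)} (hreg : RegPr F n K ε₀ U₀)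
    (hN4 : 4 * (F.P K).L ^ (K - n) ≤ (F.P K).sitesPerDir 0) {δ : ℝ} (hδ : 0 ≤ δ)
    (hT2 : ∀ (Y : PBond (F.P K) 0 → Matrix (Fin 2) (Fin 2) ℂ) (c : PBond (F.P n) 0),
      ‖QSym F n K h U₀ Y c -
          star (transfUp (axialT U₀ (toFine (K - n) (bondShift (F.sitesPerDir_eq (m := F.m) (K := n) (j := 0) (m' := F.m) (K' := K) (j' := K - n) (by omega)) c).src)) (K - n)
              (bondShift (F.sitesPerDir_eq (m := F.m) (K := n) (j := 0) (m' := F.m) (K' := K) (j' := K - n) (by omega)) c).src : Matrix (Fin 2) (Fin 2) ℂ) *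
            QSym F n K h 1 (fun b => ((axialT U₀ (toFine (K - n) (bondShift (F.sitesPerDir_eq (m := F.m) (K := n) (j := 0) (m' := F.m) (K' := K) (j' := K - n) (by omega)) c).src)
                b.src : Matrix.specialUnitaryGroup (Fin 2) ℂ) : Matrix (Fin 2) (Fin 2) ℂ) * Y b *
              star ((axialT U₀ (toFine (K - n) (bondShift (F.sitesPerDir_eq (m := F.m) (K := n) (j := 0) (m' := F.m) (K' := K) (j' := K - n) (by omega)) c).src)
                b.src : Matrix.specialUnitaryGroup (Fin 2) ℂ) : Matrix (Fin 2) (Fin 2) ℂ)) c *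
            (transfUp (axialT U₀ (toFine (K - n) (bondShift (F.sitesPerDir_eq (m := F.m) (K := n) (j := 0) (m' := F.m) (K' := K) (j' := K - n) (by omega)) c).src)) (K - n)
              (bondShift (F.sitesPerDir_eq (m := F.m) (K := n) (j := 0) (m' := F.m) (K' := K) (j' := K - n) (by omega)) c).src : Matrix (Fin 2) (Fin 2) ℂ)‖ ≤ δ * ‖Y‖)
    (hwin : δ * (1056 / (F.L : ℝ) ^ (K - n)) + 67584 * ε₀ ≤ 1 / 2) :
    ∃ H : (PBond (F.P n) 0 → Matrix (Fin 2) (Fin 2) ℂ) →ₗ[ℂ] (PBond (F.P K) 0 → Matrix (Fin 2) (Fin 2) ℂ),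
      (∀ X, QSym F n K h U₀ (H X) = X) ∧ ∀ X, ‖H X‖ ≤ 2 * (1056 / (F.L : ℝ) ^ (K - n)) * ‖X‖ := by
  have hε₀ : 0 ≤ ε₀ := (pos_of_regPr F hreg).le
  obtain ⟨R₀, -, hβ, hγ⟩ := exists_obLift_gaugeKernel_complex (N := Fin 2) (F := F) (K := K) (k := K - n) (Nat.sub_le K n) (three_le_pow_L F hnK)
    (fun c => axialT U₀ (toFine (K - n) c.src))
  have hB₁ : (0 : ℝ) ≤ 1056 / (F.L : ℝ) ^ (K - n) := by positivity
  have hd : (((F.P K).d : ℕ) : ℝ) = 3 := by rw [T3Family.P_d]; norm_num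
  have hL : (0 : ℝ) < (F.L : ℝ) ^ (K - n) := by
    have : (0 : ℝ) < F.L := by have := F.hL.2; exact_mod_cast (by omega : 0 < F.L)
    positivity
  -- (γ) at `ω = 8ε₀`: the defect `67584·ε₀·‖u‖`
  have hγ' : ∀ (c : PBond (F.P K) (K - n)) (u : PBond (F.P K) (K - n) → Matrix (Fin 2) (Fin 2) ℂ),
      ‖star (transfUp (axialT U₀ (toFine (K - n) c.src)) (K - n) c.src : Matrix (Fin 2) (Fin 2) ℂ) *
            linAvgIterM (K - n) (fun b => ((axialT U₀ (toFine (K - n) c.src) b.src : Matrix.specialUnitaryGroup (Fin 2) ℂ) : Matrix (Fin 2) (Fin 2) ℂ) * R₀ u b *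
              star ((axialT U₀ (toFine (K - n) c.src) b.src : Matrix.specialUnitaryGroup (Fin 2) ℂ) : Matrix (Fin 2) (Fin 2) ℂ)) c *
            (transfUp (axialT U₀ (toFine (K - n) c.src)) (K - n) c.src : Matrix (Fin 2) (Fin 2) ℂ) - u c‖ ≤ 67584 * ε₀ * ‖u‖ := by
    intro c u
    have h1 := hγ c u (8 * ε₀) (by positivity) (fun b hb1 hb2 c' hc' => osc_centreAxial_of_regPr F hreg hN4 c b hb1 hb2 c' hc')
    have e1 : ((((F.P K).d : ℝ) + 1) * (F.L : ℝ) ^ (K - n)) * ((1056 / (F.L : ℝ) ^ (K - n)) * ((2 * (8 * ε₀)) * ‖u‖)) = 67584 * ε₀ * ‖u‖ := by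
      rw [hd]; field_simp; ring
    rw [e1] at h1
    exact h1
  exact exists_rightInv_QSym_of_T1T2 F h U₀ (fun c => axialT U₀ (toFine (K - n) c.src)) R₀ hB₁ (by positivity) hδ hβ hγ' hT2 hwin

/-- ★★★ The same with the k- and L-FREE constant: `‖H X‖ ≤ 2112·‖X‖` (`L^{K−n} ≥ 1`). [cite: Balaban1985Variational, (45)-(46) p.285] -/
theorem exists_rightInv_QSym_of_regPr_of_T2_abs (hnK : n < K) {ε₀ : ℝ} {U₀ : GaugeField (F.P K) 0 (Matrix.specialUnitaryGroup (Fin 2) ℂ)} (hreg : RegPr F n K ε₀ U₀)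
    (hN4 : 4 * (F.P K).L ^ (K - n) ≤ (F.P K).sitesPerDir 0) {δ : ℝ} (hδ : 0 ≤ δ)
    (hT2 : ∀ (Y : PBond (F.P K) 0 → Matrix (Fin 2) (Fin 2) ℂ) (c : PBond (F.P n) 0),
      ‖QSym F n K h U₀ Y c -
          star (transfUp (axialT U₀ (toFine (K - n) (bondShift (F.sitesPerDir_eq (m := F.m) (K := n) (j := 0) (m' := F.m) (K' := K) (j' := K - n) (by omega)) c).src)) (K - n)
              (bondShift (F.sitesPerDir_eq (m := F.m) (K := n) (j := 0) (m' := F.m) (K' := K) (j' := K - n) (by omega)) c).src : Matrix (Fin 2) (Fin 2) ℂ) *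
            QSym F n K h 1 (fun b => ((axialT U₀ (toFine (K - n) (bondShift (F.sitesPerDir_eq (m := F.m) (K := n) (j := 0) (m' := F.m) (K' := K) (j' := K - n) (by omega)) c).src)
                b.src : Matrix.specialUnitaryGroup (Fin 2) ℂ) : Matrix (Fin 2) (Fin 2) ℂ) * Y b *
              star ((axialT U₀ (toFine (K - n) (bondShift (F.sitesPerDir_eq (m := F.m) (K := n) (j := 0) (m' := F.m) (K' := K) (j' := K - n) (by omega)) c).src)
                b.src : Matrix.specialUnitaryGroup (Fin 2) ℂ) : Matrix (Fin 2) (Fin 2) ℂ)) c *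
            (transfUp (axialT U₀ (toFine (K - n) (bondShift (F.sitesPerDir_eq (m := F.m) (K := n) (j := 0) (m' := F.m) (K' := K) (j' := K - n) (by omega)) c).src)) (K - n)
              (bondShift (F.sitesPerDir_eq (m := F.m) (K := n) (j := 0) (m' := F.m) (K' := K) (j' := K - n) (by omega)) c).src : Matrix (Fin 2) (Fin 2) ℂ)‖ ≤ δ * ‖Y‖)
    (hwin : δ * (1056 / (F.L : ℝ) ^ (K - n)) + 67584 * ε₀ ≤ 1 / 2) :
    ∃ H : (PBond (F.P n) 0 → Matrix (Fin 2) (Fin 2) ℂ) →ₗ[ℂ] (PBond (F.P K) 0 → Matrix (Fin 2) (Fin 2) ℂ),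
      (∀ X, QSym F n K h U₀ (H X) = X) ∧ ∀ X, ‖H X‖ ≤ 2112 * ‖X‖ := by
  obtain ⟨H, hH, hHn⟩ := exists_rightInv_QSym_of_regPr_of_T2 F h hnK hreg hN4 hδ hT2 hwin
  refine ⟨H, hH, fun X => (hHn X).trans (mul_le_mul_of_nonneg_right ?_ (norm_nonneg X))⟩
  have hL1 : (1 : ℝ) ≤ (F.L : ℝ) ^ (K - n) := by
    have : (1 : ℝ) ≤ F.L := by have := F.hL.2; exact_mod_cast (by omega : 1 ≤ F.L)
    exact one_le_pow₀ this
  have : 1056 / (F.L : ℝ) ^ (K - n) ≤ 1056 := div_le_self (by norm_num) hL1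
  linarith

end RegPr

end Summit.QuantumFields.YangMills.Theorems.Prop7QSymCovCandidate

end
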